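import Literature.NumberTheory.GelbartRogawski1991.OscillatorTripleDictionary
import Literature.NumberTheory.Automorphic.Liu2021.Def411AsPrinted
import Mathlib.RepresentationTheory.Irreducible
import Mathlib.Algebra.DirectSum.Module
import HarnessLib

/-!
# [Liu 2021] proof of Prop. 4.13, l. 2131–2146, at `n = 3` (Rem. 4.14): the constituents of `H¹_{B,τ'}(A_∞, ℂ)` ARE the
# `ω(μ, ε, χ)`, through a bijection of index sets — from the oscillator-triple dictionary, multiplicity one and Def. 4.11

Topic `NumberTheory/Automorphic/Liu2021`.  KERNEL ONLY: theorems, no definition, no named fact, no `sorry`; nothing of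
[Liu2021] / [GR91] / [Rog90] is asserted — the three printed inputs enter as HYPOTHESES on the consumer's datum
`P : Prop413Data F E` (the datum of `Prop413AsPrinted`, i.e. the REAL carriers the binders `h411`/`h413` of the HodgeCM headline
quantify over):

* `hdict : GelbartRogawski1991.oscillatorTriple_dictionary P` — [GR91, Introduction p. 448 L30–33, Thm 5.1.1] read in Liu's labels
  ([Liu2021, Rem. 4.14]; proved for every `n` at [Liu2021, proof of Prop. 4.13, l. 2145]): every IRREDUCIBLE constituent of
  `H¹_{B,τ'}(A_∞, ℂ)` is `≅ ω_t` for an admissible weight-one triple `t`, the label being unique (cell hodgecm-mathlib row B3-12 (a));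
* `hm : P.MultOneAsPrinted` — [Liu2021, proof of Prop. 4.13, last sentence l. 2145]: `dim_ℂ Hom_{ℂ[G]}(ω_t, H¹_{B,τ'}(A_∞, ℂ)) = 1`
  for every admissible weight-one `t` (at `n = 3`: [Rog90, Thm. 13.3.1] multiplicity one + the uniqueness of the triple);
* `hirr : ∀ t : P.AdmTriple, IsIrreducibleOrZero (P.rhoAt t)` — [Liu2021, Def. 4.11] «`ω(μ, ε, χ) := ⊗'_v ω(μ_v, ε_v, χ_v)`, which is
  an irreducible admissible representation» (READING I1 of `Def411AsPrinted`: irreducible-or-zero), at the admissible triples only.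

## What is proved

With `P.n = 3`, for every embedding `τ'` and every `𝔾(𝔸_F^∞)`-equivariant decomposition `Ψ : H¹_{B,τ'}(A_∞, ℂ) ≃ ⨁_i W_i` into
IRREDUCIBLE representations `(W_i, ρ_i)`:

* `Prop413Data.occursInH1_constituent` — each constituent `W_i` OCCURS in `H¹_{B,τ'}` (`OccursInH1`, via `Ψ⁻¹ ∘ ι_i`);
* `Prop413Data.exists_admTriple_of_constituent` — **every constituent is some `ω(μ, ε, χ)`**: `W_i ≅ ω_t` for an admissible
  weight-one `t` (from `hdict`) — milestone (b) of the cell's KEY `a3-u21-theta-classification`;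
* `Prop413Data.constituent_label_injective` — two DISTINCT constituents are never isomorphic to the same `ω_t` (from `hm`, `≤ 1`);
* `Prop413Data.exists_constituent_isIsoToOmega` — every admissible weight-one `ω_t` IS (isomorphic to) some constituent
  (from `hm`, `≥ 1`, the irreducibility of `ω_t` — `hirr` + non-vanishing forced by `hm` — and Schur: Mathlib
  `Representation.IsIrreducible.bijective_or_eq_zero`);
* **`Prop413Data.constituents_classified_of_dictionary_of_multOne`** — the assembly: there is a bijection
  `e : P.AdmTriple ≃ ι` with `W_{e t} ≅ ω_t` equivariantly for every `t`.  Its conclusion is, CHARACTER FOR CHARACTER, the body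
  of the predicate `ConstituentsAreTheta P τ'` of the hodgecm-mathlib crux skeleton `Lines/a3-liu413.lean` (:124–:129) — the
  ARITHMETIC half of [Liu2021, Prop. 4.13] — so that skeleton's `stub_constituentsTheta` closes by `exact` once the three
  hypotheses are supplied at its datum.

Under multiplicity one the matching of an ARBITRARY irreducible decomposition with the printed one is elementary (the label
map `i ↦ t(i)` is a bijection); no Krull–Schmidt–Azumaya theorem is used.  `GelbartRogawski1991.muAdmissible_iff_multiplicity_one`
(B3-12 (c)) is NOT needed: the occurrence of every admissible `ω_t` is already the `≥ 1` half of `MultOneAsPrinted`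
(`OscillatorTripleDictionary.occursInH1_rhoAt_of_multOne`).

NOT here: Prop. 4.13 itself (`Prop413AsPrinted`; it follows from this file plus an irreducible decomposition — the ANALYTIC half,
Matsushima, `Lines/a3-liu413.lean`'s `prop413AsPrinted_of_parts`), any statement about a particular `P`.

## References
* [Liu2021] Y. Liu, *Fourier–Jacobi cycles and arithmetic relative trace formula*, Camb. J. Math. **9** (2021) = arXiv:2102.11518 —
  Prop. 4.13 (FJcycle.tex ll. 2113–2119) with its proof ll. 2121–2146 (l. 2131, l. 2145), Rem. 4.14 (l. 2148), Def. 4.11 (ll. 2083–2097).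
* [GelbartRogawski1991] S. Gelbart, J. Rogawski, Invent. Math. **105** (1991), Introduction p. 448 L30–33, Thm 5.1.1 p. 465, p. 447 L6–8.
* [Rogawski1990] J. Rogawski, Ann. of Math. Stud. **123**, Thm. 13.3.1.
* Tree: `GelbartRogawski1991/OscillatorTripleDictionary.lean` (`oscillatorTriple_dictionary`, `OccursInH1`, `IsIsoToOmega`,
  `admTriple_unique`, `occursInH1_rhoAt_of_multOne`), `Liu2021/Prop413MultOneAsPrinted.lean` (`MultOneAsPrinted.exists_eq_smul`),
  `Liu2021/Def411AsPrinted.lean` (`IsIrreducibleOrZero`, `isIrreducible_of_nontrivial`), Mathlib `RepresentationTheory/Irreducible`.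
-/

noncomputable section

open NumberField DirectSum

namespace Literature.NumberTheory.Automorphic.Liu2021

namespace Prop413Data

open Literature.NumberTheory.GelbartRogawski1991 Literature.NumberTheory.GelbartRogawski1991.OscillatorTripleDictionary

variable {F E : Type} [Field F] [NumberField F] [IsTotallyReal F] [Field E] [NumberField E] [Algebra F E]
  [IsTotallyComplex E] [Algebra.IsQuadraticExtension F E] {P : Prop413Data F E}

/-! ## Two small facts about irreducible representations (Mathlib currency) -/

/-- An irreducible representation lives on a non-zero space (Mathlib: irreducible = the lattice of subrepresentations is simple,
in particular non-trivial). [folklore] -/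
private theorem nontrivial_of_isIrreducible {G V : Type} [Group G] [AddCommGroup V] [Module ℂ V] (ρ : Representation ℂ G V)
    (h : ρ.IsIrreducible) : Nontrivial V := by
  haveI := h
  haveI : IsSimpleModule (MonoidAlgebra ℂ G) ρ.asModule := (Representation.irreducible_iff_isSimpleModule_asModule ρ).mp h
  have : Nontrivial ρ.asModule := IsSimpleModule.nontrivial (MonoidAlgebra ℂ G) ρ.asModule
  exact this

/-- An intertwining map out of the zero representation is zero. [folklore] -/
private theorem intertwiningMap_eq_zero_of_subsingleton {G V W : Type} [Group G] [AddCommGroup V] [Module ℂ V] [AddCommGroup W]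
    [Module ℂ W] {ρ : Representation ℂ G V} {σ : Representation ℂ G W} [Subsingleton V]
    (j : Representation.IntertwiningMap ρ σ) : j = 0 := by
  apply Representation.IntertwiningMap.ext
  ext v
  rw [Subsingleton.elim v 0]
  simp

/-! ## The constituents of an equivariant decomposition `Ψ : H¹_{B,τ'}(A_∞, ℂ) ≃ ⨁_i W_i` -/

section Decomposition

variable {τ' : E →+* ℂ} {ι : Type} {W : ι → Type} [∀ i, AddCommGroup (W i)] [∀ i, Module ℂ (W i)]
  (ρ : ∀ i, Representation ℂ P.G (W i)) (Ψ : P.HB τ' ≃ₗ[ℂ] (⨁ i, W i))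
  (hΨ : ∀ (g : P.G) (x : P.HB τ') (i : ι), Ψ (P.rhoB τ' g x) i = ρ i g (Ψ x i))

include hΨ

/-- **The `i`-th constituent embeds into `H¹_{B,τ'}(A_∞, ℂ)`**: `w ↦ Ψ⁻¹(ι_i w)` is an injective `𝔾(𝔸_F^∞)`-intertwining map
`W_i → H¹_{B,τ'}` (bookkeeping on the decomposition of [Liu2021, proof of Prop. 4.13, l. 2131]).
[cite: Liu2021, proof of Prop. 4.13, l. 2131] -/
theorem exists_intertwiningMap_constituent [DecidableEq ι] (i : ι) :
    ∃ j : Representation.IntertwiningMap (ρ i) (P.rhoB τ'), Function.Injective j ∧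
      ∀ w : W i, Ψ (j w) = DirectSum.lof ℂ ι W i w := by
  refine ⟨LinearMap.intertwiningMap_of_isIntertwiningMap (ρ i) (P.rhoB τ')
    (Ψ.symm.toLinearMap ∘ₗ DirectSum.lof ℂ ι W i) (fun g w => ?_), fun a b hab => ?_, fun w => ?_⟩
  · -- equivariance: `Ψ⁻¹ (ι_i (ρ_i g w)) = ρ_B g (Ψ⁻¹ (ι_i w))`, checked after applying `Ψ` componentwise
    simp only [LinearMap.coe_comp, LinearEquiv.coe_coe, Function.comp_apply]
    apply Ψ.injective
    rw [LinearEquiv.apply_symm_apply]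
    refine DFinsupp.ext fun k => ?_
    rw [hΨ g (Ψ.symm (DirectSum.lof ℂ ι W i w)) k, LinearEquiv.apply_symm_apply]
    by_cases hki : k = i
    · subst hki
      simp only [DirectSum.lof_eq_of, DirectSum.of_eq_same]
    · rw [DirectSum.lof_eq_of, DirectSum.lof_eq_of, DirectSum.of_eq_of_ne _ _ _ hki, DirectSum.of_eq_of_ne _ _ _ hki, map_zero]
  · simp only [LinearMap.toIntertwiningMap, LinearMap.coe_comp, LinearEquiv.coe_coe, Function.comp_apply] at hab
    exact DirectSum.of_injective (β := fun k => W k) i (Ψ.symm.injective hab)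
  · simp only [LinearMap.toIntertwiningMap, LinearMap.coe_comp, LinearEquiv.coe_coe, Function.comp_apply,
      LinearEquiv.apply_symm_apply]

/-- **The projection onto the `i`-th constituent** `x ↦ (Ψ x)_i` is a `𝔾(𝔸_F^∞)`-intertwining map `H¹_{B,τ'} → W_i`.
[cite: Liu2021, proof of Prop. 4.13, l. 2131] -/
theorem exists_intertwiningMap_component (i : ι) :
    ∃ q : Representation.IntertwiningMap (P.rhoB τ') (ρ i), ∀ x : P.HB τ', q x = Ψ x i := by
  classical
  refine ⟨LinearMap.intertwiningMap_of_isIntertwiningMap (P.rhoB τ') (ρ i)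
    (DirectSum.component ℂ ι W i ∘ₗ Ψ.toLinearMap) (fun g x => ?_), fun x => ?_⟩
  · simp only [LinearMap.coe_comp, LinearEquiv.coe_coe, Function.comp_apply, ← DirectSum.apply_eq_component]
    exact hΨ g x i
  · simp only [LinearMap.toIntertwiningMap, LinearMap.coe_comp, LinearEquiv.coe_coe, Function.comp_apply,
      ← DirectSum.apply_eq_component]

/-- **Each irreducible constituent OCCURS in `H¹_{B,τ'}(A_∞, ℂ)`** («`π` contributes to the Albanese», [Liu2021, l. 2131], read on the
finite part: `OccursInH1`). [cite: Liu2021, proof of Prop. 4.13, l. 2131] -/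
theorem occursInH1_constituent (i : ι) (hirr : (ρ i).IsIrreducible) : OccursInH1 P τ' (ρ i) := by
  classical
  obtain ⟨j, hj, -⟩ := exists_intertwiningMap_constituent ρ Ψ hΨ i
  haveI := nontrivial_of_isIrreducible (ρ i) hirr
  obtain ⟨w, hw⟩ := exists_ne (0 : W i)
  refine ⟨j, fun h0 => hw (hj ?_)⟩
  rw [h0, map_zero]
  rfl

/-- **Milestone (b): every constituent is some `ω(μ, ε, χ)`.**  At `n = 3`, given the oscillator-triple dictionary
([GR91] p. 448 + Thm 5.1.1 in Liu's labels, [Liu2021, Rem. 4.14]; [Liu2021, proof of Prop. 4.13, l. 2145] in general), every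
IRREDUCIBLE constituent `W_i` of an equivariant decomposition of `H¹_{B,τ'}(A_∞, ℂ)` is `𝔾(𝔸_F^∞)`-equivariantly isomorphic to `ω_t`
for some adèlic oscillator triple `t = (μ, ε, χ)` with `μ` of weight one and `ε` `μ`-admissible.
[cite: Liu2021, proof of Prop. 4.13, l. 2145; Rem. 4.14] [cite: GelbartRogawski1991, Introduction p. 448 L30–33; Thm 5.1.1 p. 465] -/
theorem exists_admTriple_of_constituent (hdict : oscillatorTriple_dictionary P) (hn : P.n = 3) (i : ι)
    (hirr : (ρ i).IsIrreducible) :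
    ∃ t : P.AdmTriple, ∃ f : W i ≃ₗ[ℂ] P.omegaAt t, ∀ (g : P.G) (w : W i), f (ρ i g w) = P.rhoAt t g (f w) :=
  exists_admTriple hdict hn τ' (ρ i) hirr (occursInH1_constituent ρ Ψ hΨ i hirr)

/-- **Distinct constituents carry distinct labels** (multiplicity `≤ 1`): if `W_i ≅ ω_t ≅ W_j` equivariantly for ONE admissible
weight-one `t` and `W_i ≠ 0`, then `i = j` — else `Ψ⁻¹ ∘ ι_i ∘ f_i⁻¹` and `Ψ⁻¹ ∘ ι_j ∘ f_j⁻¹` are two non-proportional intertwiners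
`ω_t → H¹_{B,τ'}`, against `dim Hom_{ℂ[G]}(ω_t, H¹_{B,τ'}) = 1` ([Liu2021, l. 2145]; at `n = 3` [Rog90, Thm. 13.3.1]).
[cite: Liu2021, proof of Prop. 4.13, l. 2145] [cite: Rogawski1990, Thm. 13.3.1] -/
theorem constituent_label_injective (hm : P.MultOneAsPrinted) (hn : 3 ≤ P.n) {i j : ι} (t : P.AdmTriple)
    [Nontrivial (W i)] (hi : IsIsoToOmega P (ρ i) t.1) (hj : IsIsoToOmega P (ρ j) t.1) : i = j := by
  classical
  by_contra hij
  obtain ⟨fi, hfi⟩ := hi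
  obtain ⟨fj, hfj⟩ := hj
  obtain ⟨ji, hji, hjiΨ⟩ := exists_intertwiningMap_constituent ρ Ψ hΨ i
  obtain ⟨jj, hjj, hjjΨ⟩ := exists_intertwiningMap_constituent ρ Ψ hΨ j
  -- the inverse isomorphisms `ω_t → W_i`, `ω_t → W_j` are equivariant
  have hfi' : ∀ (g : P.G) (v : P.omegaAt t), fi.symm (P.rhoAt t g v) = ρ i g (fi.symm v) := by
    intro g v
    apply fi.injective
    rw [LinearEquiv.apply_symm_apply, hfi, LinearEquiv.apply_symm_apply]
  have hfj' : ∀ (g : P.G) (v : P.omegaAt t), fj.symm (P.rhoAt t g v) = ρ j g (fj.symm v) := by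
    intro g v
    apply fj.injective
    rw [LinearEquiv.apply_symm_apply, hfj, LinearEquiv.apply_symm_apply]
  let Fi : Representation.IntertwiningMap (P.rhoAt t) (ρ i) :=
    LinearMap.intertwiningMap_of_isIntertwiningMap (P.rhoAt t) (ρ i) fi.symm.toLinearMap hfi'
  let Fj : Representation.IntertwiningMap (P.rhoAt t) (ρ j) :=
    LinearMap.intertwiningMap_of_isIntertwiningMap (P.rhoAt t) (ρ j) fj.symm.toLinearMap hfj'
  let A : Representation.IntertwiningMap (P.rhoAt t) (P.rhoB τ') := ji.comp Fi
  let B : Representation.IntertwiningMap (P.rhoAt t) (P.rhoB τ') := jj.comp Fj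
  have hA : ∀ v, A v = ji (fi.symm v) := fun v => rfl
  have hB : ∀ v, B v = jj (fj.symm v) := fun v => rfl
  -- `ω_t ≠ 0` (it is `≅ W_i ≠ 0`), so `A ≠ 0`
  obtain ⟨w, hw⟩ := exists_ne (0 : W i)
  have hA0 : A ≠ 0 := by
    intro h0
    have h1 : A (fi w) = 0 := by rw [h0]; rfl
    rw [hA, LinearEquiv.symm_apply_apply] at h1
    exact hw (hji (by rw [h1, map_zero]))
  obtain ⟨c, hc⟩ := hm.exists_eq_smul hn τ' t hA0 B
  -- compare the `i`-th components after `Ψ`: `(Ψ (B v))_i = 0`, `(Ψ (c • A v))_i = c • fi⁻¹ v`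
  have hcomp : ∀ v : P.omegaAt t, c • fi.symm v = 0 := by
    intro v
    have h1 : Ψ (B v) i = Ψ ((c • A) v) i := by rw [hc]
    have h2 : Ψ (B v) i = 0 := by
      rw [hB, hjjΨ, DirectSum.lof_eq_of, DirectSum.of_eq_of_ne _ _ _ hij]
    have h3 : Ψ ((c • A) v) i = c • fi.symm v := by
      rw [Representation.IntertwiningMap.smul_apply, map_smul, DirectSum.smul_apply, hA, hjiΨ, DirectSum.lof_apply]
    rw [← h3, ← h1, h2]
  have hc0 : c = 0 := by
    have h1 := hcomp (fi w)
    rw [LinearEquiv.symm_apply_apply] at h1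
    exact (smul_eq_zero.mp h1).resolve_right hw
  have hB0 : B = 0 := by rw [hc, hc0, zero_smul]
  -- but `B (fj w') ≠ 0` for `w' ≠ 0` in `W_j`; and `W_j ≅ ω_t ≅ W_i ≠ 0`
  have hv : fi w ≠ 0 := fun h => hw (by simpa using congrArg fi.symm h)
  have h1 : B (fi w) = 0 := by rw [hB0]; rfl
  rw [hB] at h1
  have h2 : fj.symm (fi w) = 0 := hjj (by rw [h1, map_zero])
  exact hv (by simpa using congrArg fj h2)

/-- **Every admissible weight-one `ω_t` IS a constituent** (multiplicity `≥ 1` + Schur): `dim Hom_{ℂ[G]}(ω_t, H¹_{B,τ'}) = 1` gives a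
non-zero intertwiner `ω_t → H¹_{B,τ'} ≃ ⨁_i W_i`; some component `ω_t → W_i` is non-zero, hence — `ω_t` irreducible ([Liu2021,
Def. 4.11]; non-zero because its multiplicity is `1`) and `W_i` irreducible — bijective (Mathlib
`Representation.IsIrreducible.bijective_or_eq_zero`), i.e. `W_i ≅ ω_t` equivariantly.
[cite: Liu2021, proof of Prop. 4.13, l. 2145; Def. 4.11] -/
theorem exists_constituent_isIsoToOmega (hm : P.MultOneAsPrinted) (hn : 3 ≤ P.n)
    (hirr : ∀ t : P.AdmTriple, IsIrreducibleOrZero (P.rhoAt t)) (hirrW : ∀ i, (ρ i).IsIrreducible) (t : P.AdmTriple) :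
    ∃ i : ι, IsIsoToOmega P (ρ i) t.1 := by
  classical
  obtain ⟨j, hj⟩ := occursInH1_rhoAt_of_multOne hm hn τ' t
  -- `ω_t ≠ 0`
  haveI : Nontrivial (P.omegaAt t) := by
    by_contra hnt
    haveI : Subsingleton (P.omegaAt t) := not_nontrivial_iff_subsingleton.mp hnt
    exact hj (intertwiningMap_eq_zero_of_subsingleton j)
  haveI hirrt : (P.rhoAt t).IsIrreducible := isIrreducible_of_nontrivial (hirr t)
  -- a vector with `j v ≠ 0`, and a component `i` with `(Ψ (j v))_i ≠ 0`
  obtain ⟨v, hv⟩ : ∃ v, j v ≠ 0 := by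
    by_contra h
    push Not at h
    exact hj (Representation.IntertwiningMap.ext (LinearMap.ext fun v => by simpa using h v))
  have hΨv : Ψ (j v) ≠ 0 := fun h => hv (by simpa using congrArg Ψ.symm h)
  obtain ⟨i, hi⟩ : ∃ i, Ψ (j v) i ≠ 0 := by
    by_contra h
    push Not at h
    exact hΨv (DFinsupp.ext h)
  obtain ⟨q, hq⟩ := exists_intertwiningMap_component ρ Ψ hΨ i
  -- `q ∘ j : ω_t → W_i` is a non-zero intertwiner between irreducibles, hence bijective
  let Q : Representation.IntertwiningMap (P.rhoAt t) (ρ i) := q.comp j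
  have hQ : ∀ u, Q u = Ψ (j u) i := fun u => by
    show q (j u) = _
    exact hq (j u)
  have hQ0 : Q ≠ 0 := by
    intro h0
    apply hi
    rw [← hQ, h0]
    rfl
  haveI := hirrW i
  have hbij : Function.Bijective Q := (Representation.IsIrreducible.bijective_or_eq_zero Q).resolve_right hQ0
  let eQ : P.omegaAt t ≃ₗ[ℂ] W i := LinearEquiv.ofBijective Q.toLinearMap hbij
  have heQ : ∀ u, eQ u = Q u := fun u => rfl
  refine ⟨i, eQ.symm, fun g w => ?_⟩
  apply eQ.injective
  rw [LinearEquiv.apply_symm_apply, heQ]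
  show _ = Q (P.rhoAt t g (eQ.symm w))
  rw [Representation.IntertwiningMap.isIntertwining, ← heQ, LinearEquiv.apply_symm_apply]

end Decomposition

/-! ## The classification of the constituents (the ARITHMETIC half of [Liu2021, Prop. 4.13], `n = 3`) -/

/-- **[Liu2021, proof of Prop. 4.13 (l. 2131–2146) at `n = 3` (Rem. 4.14)]: in ANY `𝔾(𝔸_F^∞)`-equivariant decomposition of
`H¹_{B,τ'}(A_∞, ℂ)` into irreducibles `⊕_i W_i`, the constituents are — through a bijection `e` of index sets — exactly the adèlic
oscillator representations `ω(μ, ε, χ)` over the triples with `μ` of weight one and `ε` `μ`-admissible, `W_{e(μ,ε,χ)} ≅ ω(μ, ε, χ)`.**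
FROM: the oscillator-triple dictionary `hdict` ([GR91] p. 448 L30–33 + Thm 5.1.1 in Liu's labels — [Liu2021, Rem. 4.14] — i.e. «every
constituent is `π^∞ ≅ ω(μ,ε,χ)` for a unique admissible weight-one triple», l. 2145), multiplicity one `hm`
(`dim Hom_{ℂ[G]}(ω_t, H¹_{B,τ'}) = 1`, l. 2145; [Rog90, Thm. 13.3.1]) and [Liu2021, Def. 4.11]'s «irreducible» for the admissible
`ω_t` (`hirr`, irreducible-or-zero; non-vanishing is forced by `hm`).  PROOF: label each constituent by `hdict`
(`exists_admTriple_of_constituent`); the label map is injective by `hm` (`constituent_label_injective`) and surjective by `hm` + Schur +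
uniqueness of the label (`exists_constituent_isIsoToOmega`, `admTriple_unique`); invert it.  The conclusion is VERBATIM the body of
`ConstituentsAreTheta P τ'` of the hodgecm-mathlib crux skeleton `Lines/a3-liu413.lean` (:124–:129).  Nothing of the sources is
asserted: all three inputs are hypotheses on the consumer's `P`.
[cite: Liu2021, Prop. 4.13 with proof l. 2131–2146; Rem. 4.14; Def. 4.11]
[cite: GelbartRogawski1991, Introduction p. 448 L30–33; Thm 5.1.1 p. 465; p. 447 L6–8] [cite: Rogawski1990, Thm. 13.3.1] -/
theorem constituents_classified_of_dictionary_of_multOne (hdict : oscillatorTriple_dictionary P) (hm : P.MultOneAsPrinted)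
    (hirr : ∀ t : P.AdmTriple, IsIrreducibleOrZero (P.rhoAt t)) (hn : P.n = 3) (τ' : E →+* ℂ) :
    ∀ (ι : Type) (W : ι → Type) [∀ i, AddCommGroup (W i)] [∀ i, Module ℂ (W i)] (ρ : ∀ i, Representation ℂ P.G (W i)),
      (∀ i, (ρ i).IsIrreducible) →
      ∀ Ψ : P.HB τ' ≃ₗ[ℂ] (⨁ i, W i), (∀ (g : P.G) (x : P.HB τ') (i : ι), Ψ (P.rhoB τ' g x) i = ρ i g (Ψ x i)) →
        ∃ e : P.AdmTriple ≃ ι, ∀ t : P.AdmTriple, ∃ f : W (e t) ≃ₗ[ℂ] P.omegaAt t,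
          ∀ (g : P.G) (w : W (e t)), f (ρ (e t) g w) = P.rhoAt t g (f w) := by
  intro ι W _ _ ρ hirrW Ψ hΨ
  classical
  have hn3 : 3 ≤ P.n := hn.symm ▸ le_rfl
  -- label every constituent: `W_i ≅ ω_{c i}`
  have hlab : ∀ i, ∃ t : P.AdmTriple, IsIsoToOmega P (ρ i) t.1 := fun i =>
    (hdict hn τ' (W i) (ρ i) (hirrW i) (occursInH1_constituent ρ Ψ hΨ i (hirrW i))).1
  choose c hc using hlab
  -- the label map is a bijection
  have hinj : Function.Injective c := by
    intro i j hij
    haveI := nontrivial_of_isIrreducible (ρ i) (hirrW i)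
    exact constituent_label_injective ρ Ψ hΨ hm hn3 (c j) (hij ▸ hc i) (hc j)
  have hsurj : Function.Surjective c := by
    intro t
    obtain ⟨i, hi⟩ := exists_constituent_isIsoToOmega ρ Ψ hΨ hm hn3 hirr hirrW t
    exact ⟨i, admTriple_unique hdict hn τ' (ρ i) (hirrW i) (occursInH1_constituent ρ Ψ hΨ i (hirrW i)) (hc i) hi⟩
  let e : P.AdmTriple ≃ ι := (Equiv.ofBijective c ⟨hinj, hsurj⟩).symm
  refine ⟨e, fun t => ?_⟩
  have het : c (e t) = t := Equiv.ofBijective_apply_symm_apply c ⟨hinj, hsurj⟩ t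
  have h := hc (e t)
  rw [het] at h
  exact h

/-- The same with the printed hypothesis `3 ≤ n` of Prop. 4.13 made explicit in the binder list (it is implied by `P.n = 3`; this is the
exact shape `3 ≤ P.n → ∀ τ', ConstituentsAreTheta P τ'` consumed by `Lines/a3-liu413.lean`'s `prop413AsPrinted_of_parts`).
[cite: Liu2021, Prop. 4.13 with proof l. 2131–2146; Rem. 4.14] -/
theorem constituents_classified_of_dictionary_of_multOne' (hdict : oscillatorTriple_dictionary P) (hm : P.MultOneAsPrinted)
    (hirr : ∀ t : P.AdmTriple, IsIrreducibleOrZero (P.rhoAt t)) (hn : P.n = 3) :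
    3 ≤ P.n → ∀ (τ' : E →+* ℂ) (ι : Type) (W : ι → Type) [∀ i, AddCommGroup (W i)] [∀ i, Module ℂ (W i)]
      (ρ : ∀ i, Representation ℂ P.G (W i)), (∀ i, (ρ i).IsIrreducible) →
      ∀ Ψ : P.HB τ' ≃ₗ[ℂ] (⨁ i, W i), (∀ (g : P.G) (x : P.HB τ') (i : ι), Ψ (P.rhoB τ' g x) i = ρ i g (Ψ x i)) →
        ∃ e : P.AdmTriple ≃ ι, ∀ t : P.AdmTriple, ∃ f : W (e t) ≃ₗ[ℂ] P.omegaAt t,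
          ∀ (g : P.G) (w : W (e t)), f (ρ (e t) g w) = P.rhoAt t g (f w) :=
  fun _ τ' => constituents_classified_of_dictionary_of_multOne hdict hm hirr hn τ'

end Prop413Data

end Literature.NumberTheory.Automorphic.Liu2021

end
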